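import Literature.NumberTheory.LFunctions.BilinearKloostermanSumsPrimeModulus

/-!
# Route `PrimeLevelFamEdge` — TYPED IDEA DELTAS, deck 13: the `barrier` lens on BN-7a (cell ls-idea, seat
# ls-idea-lens-9, LENSES-v3 `barrier`; cards K-L9-1 «KMS CORNER» (instrument, NIL-corner) and K-L9-2 «STRUCTURE
# CONTROL» (the lens OUTPUT, conjecture shape); typed companion `Sketch_Lens9_KMSCorner.lean` sha16 ff83b288478e009e)

LANDING NOTE (typer ls-idea-typ-1 gen 2): the seat's sketch VERBATIM from its §2 on (namespace relabelled
`…Theorems.PrimeLevelFamEdgeIdeaDeltas.Barrier`, docstring tags added); §1 (the corner shape of KMS17 Thm 1.1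
and its derivation from the tree's named fact) was landed Literature-side as
`Literature.NumberTheory.LFunctions.kowalskiMichelSawin2017_cornerTypeII` / `cornerTypeII_of_theorem11`
(`BilinearKloostermanSumsPrimeModulus.lean`, appendix). Barrier-inversion of BN-7a («beat Parseval / the large
sieve at ONE modulus»; tightness witness kernel-checked p594208 `KloostermanSectors.norm_bilinearKloosterman_charTable`):
its hypotheses NAMED (H-gen) coefficient-blind · (H-one) one modulus · (H-abs) absolute values · (H-compl)
complete/folded tables · (H-bd) inequality, not evaluation · (H-size, proposed) bulk length `MN = q^{2+η}`.
Contents: exponent bookkeeping (PROVED arithmetic: KMS beats the Parseval scale iff `MN < q^{21/20}`; on the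
e-corner the exponent is `(20η+20ν−1)/64`; the BULK has `MN = q^{2+η}` in every grouping), the GL(1) toy
`toyCq` of the c = q layer, the mollifier table `mollTable`, and three PARAMETRIC candidate statements «just
outside» BN-7a: `CoeffBlindSubThreshold η A` (predicted FALSE, recorded), `MobiusToySaving η A P` (= the
requirement itself), `StructureControlToy η A B` (the lens OUTPUT, conjecture shape). NOTHING is asserted; no
exceptional-zero theorem (no Landau–Siegel / Siegel-zero exclusion, no Theorem 1–2 of arXiv:2211.02515, no
repaired Margin232) is proved by ideation; typed ≠ proved; computed ≠ proved.
-/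

noncomputable section

open scoped Classical
open Finset

namespace Summit.Parity.GeneralizedHardyLittlewood.Theorems.PrimeLevelFamEdgeIdeaDeltas.Barrier

open Literature.NumberTheory.LFunctions

/-! ### 2. Exponent bookkeeping (proved arithmetic) -/

/-- KMS's saving term `(MN)^{5/16} q^{11/64}` (with `MN = q^x`) is below the Parseval / large-sieve scale `q^{1/2}`
iff `x < 21/20` — the Type-II window in which BN-7a's line can be beaten by in-print technology. [folklore] -/
theorem kms_beats_parseval_iff (x : ℝ) : 5 * x / 16 + 11 / 64 < 1 / 2 ↔ x < 21 / 20 := by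
  constructor <;> intro h <;> linarith

/-- On the e-corner `M = q^{(1+η)/2}`, `N = q^{(1+η)/2+ν}` (so `MN = q^{1+η+ν}`) the exponent of the corner piece
relative to the main term (`/√q`) is `(20η + 20ν − 1)/64`. [folklore] -/
theorem corner_exponent (η ν : ℝ) :
    5 / 16 * (1 + η + ν) + 11 / 64 - 1 / 2 = (20 * η + 20 * ν - 1) / 64 := by ring

/-- … which is a NEGATIVE power of `q` iff `η + ν < 1/20`. [folklore] -/
theorem corner_exponent_neg_iff (η ν : ℝ) : (20 * η + 20 * ν - 1) / 64 < 0 ↔ η + ν < 1 / 20 := by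
  constructor <;> intro h <;> linarith

/-- KMS's range `MN < q^{5/4}` on the corner: `1 + η + ν < 5/4 ↔ η + ν < 1/4`. [folklore] -/
theorem corner_in_kms_range_iff (η ν : ℝ) : 1 + η + ν < 5 / 4 ↔ η + ν < 1 / 4 := by
  constructor <;> intro h <;> linarith

/-- On the corner the `N^{1/2}` term is dominated by the saving term: `(1+η+2ν)/4 ≤ (20(1+η+ν)+11)/64`
whenever `ν < 1/4` and `η ≥ −1`. [folklore] -/
theorem corner_first_term_dominated (η ν : ℝ) (hν : ν < 1 / 4) (hη : -1 ≤ η) :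
    (1 + η + 2 * ν) / 4 ≤ (20 * (1 + η + ν) + 11) / 64 := by
  have : 12 * ν ≤ 15 + 4 * η := by linarith
  linarith

/-- Every bilinear grouping of the BULK of the four-variable form has total length `MN = q^{2+η}`, outside the
window `MN < q^{21/20}` for every `η > −19/20` (in particular for every `Δ′ = 1 + η > 1`): KMS17's Type-II
window does not reach there (hypothesis (H-size) proposed to barrier-notes; further one-prime-modulus notches in
print — Shkredov 2021 Thm 4, Pascadi 2025 Thm 1.1 — are referee D b15's FIX-ONCE on the card's wording, not typed here). [folklore] -/
theorem bulk_outside_kms_window (η : ℝ) (hη : -19 / 20 < η) : ¬ (2 + η < 21 / 20) := by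
  intro h; linarith

/-! ### 3. The GL(1) toy of the c = q layer and the two candidate «just-outside» statements -/

/-- The GL(1) toy (no J-Bessel factor, sharp AFE cut-off `E`) of the c = q off-diagonal layer at ONE prime `q` for a
coefficient table `a` on `[1, L]`:
`T_q(a; L, E) = q^{-1} Σ_{d₁,d₂ ≤ L} Σ_{e₁,e₂ ≤ E} a(d₁)a(d₂)(e₁e₂)^{-1/2} S(1, d₁d₂e₁e₂; q)`
(`= (1/(qφ(q))) Σ_χ τ(χ)² L_E(χ̄)² A(χ̄)²`, `A(χ̄) = Σ_d a(d)χ̄(d)`, `L_E(χ̄) = Σ_{e ≤ E} χ̄(e)e^{-1/2}`).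
TYPING NOTE (referee B b95 P-L9-B1/B3): this def uses the SHARP cut-off `e ≤ E` (weight `1`); the seat's
numerics `cq_toy.py` of record use `V = 1` on `[0,1]` and `cos²(π(t−1)/2)` on `(1,2)`, and an earlier docstring
said `V = exp(−(e/√q)²)` — the numbers quoted in the candidate docstrings below refer to the script's `V`,
not to this sharp cut-off; branch `∓` fixed to `+` here. [folklore] -/
def toyCq (q : ℕ) [NeZero q] (L E : ℕ) (a : ℕ → ℂ) : ℂ :=
  (∑ d₁ ∈ Icc 1 L, ∑ d₂ ∈ Icc 1 L, ∑ e₁ ∈ Icc 1 E, ∑ e₂ ∈ Icc 1 E,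
      a d₁ * a d₂ * ((((e₁ : ℝ) * e₂) ^ (-(1 / 2 : ℝ)) : ℝ) : ℂ) *
        kloostermanSum q 1 ((d₁ : ZMod q) * (d₂ : ZMod q) * (e₁ : ZMod q) * (e₂ : ZMod q))) / (q : ℂ)

/-- The mollifier table `x̃(d) = μ(d) P(log(L/d)/log L) d^{-1/2}` on `[1, L]`. [folklore] -/
def mollTable (L : ℕ) (P : Polynomial ℝ) (d : ℕ) : ℂ :=
  (((ArithmeticFunction.moebius d : ℤ) : ℝ) * P.eval (Real.log ((L : ℝ) / d) / Real.log L) *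
    (d : ℝ) ^ (-(1 / 2 : ℝ)) : ℝ)

/-- **Candidate 1 — coefficient-BLIND sub-threshold bound for INCOMPLETE tables** (violates (H-compl): `L = q^{(1+η)/2}
< q`, nothing folds; KEEPS (H-gen)): `|T_q(a)| ≤ C (log q)^{-A} ‖a‖₂²` for all tables `a` on `[1,L]`, `q ≥ q₀` prime.
This is the literal «just-outside» statement of the lens.  PREDICTED FALSE for every `A > 0`: the flat table
`a = L^{-1/2} 1_{[1,L]}` gives exact solutions `a₁a₂ = e₁e₂` after completing `Σ_{d ≤ L} χ̄(d) = χ(−1)τ(χ̄)c_L(χ)`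
(the Gauss-sum phases cancel: `τ(χ)²τ(χ̄)² = q²`), a secondary main term of size `≍ (log q)³` — the incomplete-table
analogue of p594208's complete-table witness (own heuristic; numerics kit jobs j297765/j297866: flat table `|T_q| =
23.4, 27.4, 33.9, 38.3` at `q = 40009, 100003, 400009, 1000003`, `η = 0`, versus `μP`: `0.0085, 0.012, 0.00076, 0.00034`).
Recorded so that the next seat does not re-propose it.
[cite: KowalskiMichelSawin2017, Remark 1.2 (ranges; context)] -/
def CoeffBlindSubThreshold (η A : ℝ) : Prop :=
  ∃ C : ℝ, ∃ q₀ : ℕ, ∀ (q : ℕ) [Fact q.Prime], q₀ ≤ q → ∀ a : ℕ → ℂ,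
    ‖toyCq q ⌊(q : ℝ) ^ ((1 + η) / 2)⌋₊ ⌊Real.sqrt q⌋₊ a‖ ≤
      C * (Real.log q) ^ (-A) * ∑ d ∈ Icc 1 ⌊(q : ℝ) ^ ((1 + η) / 2)⌋₊, ‖a d‖ ^ 2

/-- **Candidate 2 — the Möbius-table saving** (violates (H-gen): the table is `μ·P`; this is BN-7a's REQUIREMENT at the
layer c = q, not an escape from it — barrier-notes caveat l.324): `|T_q(x̃)| ≤ C (log q)^{-A}` for the mollifier table,
`q ≥ q₀` prime.  NEED (door, MAIN units): some `A > 1`; Parseval/large-sieve line: `q^{η/2}·polylog`; truth heuristic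
`q^{-1/2-η/4}`.  Open; KMS17's window does not cover `MN = q^{2+η}` (`bulk_outside_kms_window`; referee D b15
lists the other printed one-modulus notches).
[cite: KowalskiMichelSawin2017, Theorem 1.1 (the in-print Type-II window; context)] -/
def MobiusToySaving (η A : ℝ) (P : Polynomial ℝ) : Prop :=
  ∃ C : ℝ, ∃ q₀ : ℕ, ∀ (q : ℕ) [Fact q.Prime], q₀ ≤ q →
    ‖toyCq q ⌊(q : ℝ) ^ ((1 + η) / 2)⌋₊ ⌊Real.sqrt q⌋₊ (mollTable ⌊(q : ℝ) ^ ((1 + η) / 2)⌋₊ P)‖ ≤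
      C * (Real.log q) ^ (-A)

/-- **Candidate 3 — the lens OUTPUT: a STRUCTURE statement for the c = q quadratic form** (violates (H-gen) MINIMALLY —
the table is arbitrary but enters only through two pseudorandomness profiles — and (H-bd)/(H-abs): it is an evaluation
with phases kept, the «main terms» being the profiles).  For every table `a` on `[1, L]`, `L = q^{(1+η)/2}`, every
`δ₁, δ₂ ≥` its two profiles —
(arcs) `sup_{e ≤ √q, j} |Σ_{d ≤ L} a(d) e(dj/e)| ≤ δ₁` (additive major arcs with denominators up to the dual length) and
(Frobenius) `sup_{u ∈ 𝔽_q^×} |Σ_{d ≤ L} a(d) Kl₂(ud; q)| ≤ δ₂` (correlation with the kernel's own trace function) —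
`|T_q(a)| ≤ C (log q)^B (δ₁² + δ₂²)/L + C (log q)^{-A} ‖a‖₂²`.
Toy evidence (kit j297866, 9 tables × q ∈ {40009, 100003, 400009, 1000003} × η ∈ {0, 0.2, 0.4}; Rayleigh quotients
`|T_q|/‖a‖₂²`): major-arc tables flat / smooth / 3ℤ-progression `12–53`; Kloosterman table `Kl₂(d)d^{-1/2}` up to `0.5`
(level-dependent, both signs equal ⇒ systematic); `μP`, Liouville, random signs, `e(d̄/q)`, cubic-character section
`≤ 0.2` and mostly `≲ 10·q^{-1/2}`.  For `a = μP`: `δ₁ ≪_A L^{1/2}(log L)^{-A'}` is Davenport's theorem (printed,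
ineffective constant); `δ₂ ≪ L^{1/2} q^{-κ}` is Fouvry–Kowalski–Michel 2014 (Thm 1.7) ONLY for `L ≥ q^{3/4+ε}`, i.e.
`η ≥ 1/2 + 2ε` — for `η < 1/2` the Frobenius profile of `μ` below the Pólya–Vinogradov range is OPEN (linear, one
variable: strictly below BN-7a's bilinear requirement in shape, not known to be easier).  CONJECTURE SHAPE, unlocated in
print at one modulus (nearest printed analogue over a FAMILY of moduli: Conrey–Iwaniec–Soundararajan's asymptotic large
sieve, arXiv:1105.1176 Thms 2.3–2.4, whose price is the same Siegel–Walfisz-type condition (2.24) on the arbitrary factor).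
Cheapest falsifier: a table with both profiles `≤ L^{1/2}(log)^{-A'}` and `|T_q(a)| ≫ ‖a‖₂²/log q` (toy script
`toy/cq_toy.py`, one kit job per candidate table). A CONJECTURE SHAPE, parametric in `(η, A, B)`; NOT asserted.
**STATUS AS TYPED (lens-9 v1.1 AMENDMENT / ERRATUM E-L9-1, 03:20–03:24Z; referee B b95 #49): REFUTED-IN-TOY AS
TYPED** — the seat's own cheapest falsifier FIRED on the additive profile `δ₁` (kit j298137: the quadratic-phase
table `e(d²φ)d^{−1/2}` has no additive major arcs yet gives `|T_q| ≈ 1.1` constant in `q`, Rayleigh quotient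
`0.15 ≫ 1/log q`; computed ≠ proved); DIAGNOSIS: the resonant functional is the windowed LOGARITHMIC MEAN of
`a(d)d^{1/2}` ALONG MULTIPLES (Farey pairs), not the additive profile; the CORRECTED shape («one-modulus asymptotic
large sieve with an explicit Farey-spike main term `Q_q` + Frobenius profile + `O((log)^{−A})`») is PROVISIONAL
(words only, §D.10) and NOT typed. This decl is kept as the record of the refuted form; do not cite it as the
lens output. Also (A-L9-6): (H-gen) cannot be relaxed to «bounded completely multiplicative» (kit j298192/j298219).
[cite: ConreyIwaniecSoundararajan2011ALS, Theorems 2.3–2.4 and (2.24) (the family analogue; context)] -/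
def StructureControlToy (η A B : ℝ) : Prop :=
  ∃ C : ℝ, 0 < C ∧ ∃ q₀ : ℕ, ∀ (q : ℕ) [Fact q.Prime], q₀ ≤ q → ∀ a : ℕ → ℂ, ∀ δ₁ δ₂ : ℝ,
    (∀ e ∈ Icc 1 ⌊Real.sqrt q⌋₊, ∀ j ∈ Finset.range e,
        ‖∑ d ∈ Icc 1 ⌊(q : ℝ) ^ ((1 + η) / 2)⌋₊,
            a d * Complex.exp (2 * Real.pi * Complex.I * ((d : ℂ) * (j : ℂ) / (e : ℂ)))‖ ≤ δ₁) →
    (∀ u : ZMod q, u ≠ 0 →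
        ‖∑ d ∈ Icc 1 ⌊(q : ℝ) ^ ((1 + η) / 2)⌋₊, a d * kl₂ q (u * (d : ZMod q))‖ ≤ δ₂) →
    ‖toyCq q ⌊(q : ℝ) ^ ((1 + η) / 2)⌋₊ ⌊Real.sqrt q⌋₊ a‖ ≤
      C * (Real.log q) ^ B * (δ₁ ^ 2 + δ₂ ^ 2) / ⌊(q : ℝ) ^ ((1 + η) / 2)⌋₊ +
        C * (Real.log q) ^ (-A) * ∑ d ∈ Icc 1 ⌊(q : ℝ) ^ ((1 + η) / 2)⌋₊, ‖a d‖ ^ 2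

end Summit.Parity.GeneralizedHardyLittlewood.Theorems.PrimeLevelFamEdgeIdeaDeltas.Barrier
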